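/-
COR-CM (cell pub-hodgecm2, stage 2 of the Hodge ladder) — TRANSPOSITION SURGE, item (vi) of rfwf v3 §4.2, sub-binder
(vi-3) WEDGE (hodge-director/ITEM6-SPLIT.md §(c′), row (vi-3); crosswalk S3): the `Within` BOOKKEEPING UPGRADE of the
leaf B01-H.  AUTHORED by seat prover-pub-hodgecm2-item6-p4-0 (unit pub-hodgecm2-item6-p4; HOME/INBOX CLAIM
2026-08-21T13:33Z l.3821, rule (1) path `Transposition/Item6HeckeFamily.lean`).  The anisotropic body re-runs, KEEPING THE
WITNESSES, the proof of `Model.heckeWedge10_body_of_isAnisotropic` staged by b06 gen 19 (bytes 2bcd0ebb6b01, filed by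
own-b01 as `CorCM/B01/HeckeWedge10Holds.lean`, p260689) over b06's Literature brick `UnitaryBallHeckeWedge` and b10's
Hecke-pair glue `CorCM/B01/HeckePair.lean`; nothing is imported from p260689.  One `def` (the Hecke family) + theorems;
nothing cited as a record; nothing asserted; FRAMING (COORDINATOR RULING 2026-08-21T11:55:35Z): HC_CM is NOT proved.
-/
import Summits.HodgeConjecture.CorCM.B01.Transposition.Item6SupplyAssembly
import Summits.HodgeConjecture.CorCM.B01.HeckePair
import Summits.HodgeConjecture.CorCM.B01.HeckeWedgeAnisotropicReduction
import Literature.AlgebraicGeometry.ShimuraVarieties.UnitaryBallHeckeWedge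
import Literature.AlgebraicGeometry.ShimuraVarieties.UnitaryBallRationalImage
import HarnessLib

/-!
# Transposition item (vi-3): the HONEST Hecke family of the universe of record, and B01-H WITHIN it

The Hecke route to PerL Prop 4.3 typed in `Transposition/Item6SupplyAssembly.lean` §2
(`FaceThetaSupply.wedge_of_translateClosed` :190) consumes two inputs over a posited `HeckeFamily U`:
`HeckeWedge10Within U Hk` (:175, B01-H with witnesses IN the family) and `S.TranslateClosed Hk` (:165, the theta sets
are stable under pull-back along the family).  For SATURATED theta sets (`Theta := U.Uiso`) any family will do
(`Universe.pullC_mem_Uiso`); for GENUINE theta sets (the stage-1 package convention: theta classes = classes of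
restrictions of adelic theta forms) translate-closure only holds along morphisms lying over RATIONAL isometries
(PerL v5 §3.1, tex ll. 652–656: `γ^* u_f = u_{R(γ_f⁻¹) f}`), so the family must be honest and B01-H must be proved
WITHIN it.  This file supplies both on the model universe `U = Model.picardCMUniverse hHD hI h₁ h₃`:

* `Transposition.Model.heckeFamily hHD hI h₁ h₃ : HeckeFamily U` — `tr Γ Γ'` is the set of morphisms
  `g : U.pms L ι₁ V Γ' ⟶ U.pms L ι₁ V Γ` for which there is a rational isometry `γ ∈ U(V₃,h)(L)`
  (`γ ∈ unitaryGroup (cmConjRingHom L) V.Hm`) with `Γ'` at least as fine as the Hecke level `Γ.heckePair γ` (`K`-order;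
  so `γ Γ' γ⁻¹ ≤ Γ`) such that, whenever the Picard codes are anisotropic
  (always the case when `2 < [L:ℚ]`, `Model.isAnisotropic_pmsCode_of_two_lt`), `g(ℂ) (unif_{Γ'} v) = unif_Γ (γ^{ι₁} v)`
  on the negative cone of the ball datum (`γ = 1`: the level coverings of `CorCM/B01/LevelCovering.lean`; general `γ`:
  the Hecke translations of `CorCM/B01/HeckePair.lean`, `Model.exists_mor_pms_map_unif_mulVec`);
* `Transposition.Model.pullC_eq_zero_of_not_isAnisotropic` — bookkeeping off the anisotropic locus (`H¹ = 0`);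
* `Transposition.Model.heckeWedge10Within_body` — at an anisotropic code, for non-zero `a, a' ∈ H^{1,0}(U.pms L ι₁ V Γ)`
  there are a rational isometry `γ` and the two Hecke projections `π_γ ∈ tr Γ (Γ.heckePair γ)` (over `γ`),
  `π ∈ tr Γ (Γ.heckePair γ)` (over `1`) with `π_γ^* a ∪ π^* a' ≠ 0` — the proof of b06's
  `Model.heckeWedge10_body_of_isAnisotropic` (dense image of `U(V₃,h)(L)` in `U(2,1)` by real approximation,
  `BallRational.dense_ratSubgroup`; the Hecke wedge of the ball quotient,
  `UnitaryBallUniformisationDatum.exists_mem_forall_cup_pull_ne_zero`; the projections, `Model.exists_mor_pms_heckePair`)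
  with the witnesses REMEMBERED;
* **`Transposition.Model.heckeWedge10Within_holds : HeckeWedge10Within U (heckeFamily hHD hI h₁ h₃)`** and, forgetting
  the family, `Transposition.Model.heckeWedge10_of_heckeFamily : U.HeckeWedge10` (the statement of p260689 by a second road;
  no refile of that file).

In print: non-vanishing of cup products of Hecke translates of holomorphic classes on compact congruence ball quotients
(Clozel, J. reine angew. Math. 444 (1993); Venkataramana, Compositio Math. 125 (2001) Thm 8 and Remark) — here a kernel
theorem of the model, not a record.  HC_CM is NOT proved; nothing here inhabits `FaceThetaDataExists`.
-/

noncomputable section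

open scoped TensorProduct Matrix
open NumberField CategoryTheory
open Literature.AlgebraicGeometry.Motives
open Literature.AlgebraicGeometry.ShimuraVarieties
open Literature.AlgebraicGeometry.HodgeTheory
open Literature.NumberTheory.Automorphic
open Literature.NumberTheory.Automorphic.PicardCM
open Literature.Geometry.ComplexHyperbolic
open Literature.Geometry.ComplexHyperbolic.BallModel (U21 Ball)

namespace Summit.HodgeConjecture.CorCM.Transposition.Model

open Summit.HodgeConjecture.CorCM.Model

/-- The Gram matrix of a hermitian 3-space is hermitian in matrix form, for Mathlib's conjugation: `ᵗ(σ Hm) = Hm`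
(`HermSpace3.isHermitian`; `IsCMField.complexConj L = cmConjRingHom L` as ring maps) — the hypothesis of
`BallRational.dense_ratSubgroup`. [folklore] -/
theorem hermSpace3_transpose_map_complexConj {L : CMField} {ι₁ : L →+* ℂ} (V : HermSpace3 L ι₁) :
    (V.Hm.map (IsCMField.complexConj L : L →+* L))ᵀ = V.Hm := by
  refine Matrix.ext fun i j => ?_
  rw [Matrix.transpose_apply, Matrix.map_apply, coe_complexConj_eq_conjRingHomK']
  exact V.isHermitian j i

/-! ## The honest Hecke family -/

/-- **The membership predicate of the honest Hecke family**: a morphism `g : U.pms L ι₁ V Γ' ⟶ U.pms L ι₁ V Γ` of the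
universe of record LIES OVER the rational isometry `γ ∈ U(V₃,h)(L)` if the level `Γ'` is at least as fine as the HECKE
LEVEL of `γ` at `Γ` (`Γ' ≤ Γ.heckePair γ hγ` in the `K`-order of levels: `K' ≤ K ∩ γ_f⁻¹ K γ_f`, hence
`Γ' ≤ Γ ∩ γ⁻¹Γγ`, `CorCM/B01/HeckePair.lean`) and, whenever the Picard codes are anisotropic,
`g(ℂ) ∘ unif_{Γ'} = unif_Γ ∘ γ^{ι₁}` on the negative cone (Shimura's `[v] ↦ [γ v]`).  The level clause is what the
automorphic side of translate-closure consumes (the translate `R(γ_f⁻¹) F` of a form of level `K` has level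
`γ_f⁻¹ K γ_f ⊇ K'`); the point-action clause is what the analytic side consumes
(`UnitaryBallClassLiftTranslate.classLift_pull_mulVec`). [cite: Shimura1973, §7.2–7.3] -/
@[folklore]
def LiesOver (hHD : exists_isReal_hodgeModel) (hI : hodgePQ_independent_of_hodgeModel) (h₁ : BallQuotientUniformised)
    (h₃ : CMAbelianVarietyRealised) {L : CMField} {ι₁ : L →+* ℂ} {V : HermSpace3 L ι₁} (Γ Γ' : Level V)
    (g : (picardCMUniverse hHD hI h₁ h₃).Mor ((picardCMUniverse hHD hI h₁ h₃).pms L ι₁ V Γ')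
      ((picardCMUniverse hHD hI h₁ h₃).pms L ι₁ V Γ))
    (γ : GL (Fin 3) L) (hγ : γ ∈ unitaryGroup (cmConjRingHom L) V.Hm) : Prop :=
  Γ' ≤ Γ.heckePair γ hγ ∧
    ∀ (h' : (pmsCode L ι₁ V Γ').IsAnisotropic) (h : (pmsCode L ι₁ V Γ).IsAnisotropic),
      ∀ v ∈ (Var.ballDatum (ballQuotientUniformisedDatum_of h₁) h₃ (pmsCode L ι₁ V Γ') h').cone,
        AlgPoints.map g ((Var.ballDatum (ballQuotientUniformisedDatum_of h₁) h₃ (pmsCode L ι₁ V Γ') h').unif v) =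
          (Var.ballDatum (ballQuotientUniformisedDatum_of h₁) h₃ (pmsCode L ι₁ V Γ) h).unif
            (((γ : Matrix (Fin 3) (Fin 3) L).map ι₁) *ᵥ v)

/-- **The honest Hecke family of the universe of record** (`Transposition.HeckeFamily`, `Item6SupplyAssembly.lean` :155):
`tr Γ Γ'` = the morphisms `U.pms L ι₁ V Γ' ⟶ U.pms L ι₁ V Γ` lying over SOME rational isometry `γ ∈ U(V₃,h)(L)` from a
level at least as fine as its Hecke level (`LiesOver`): the Hecke-translated level coverings `[v] ↦ [γ v]`.
[cite: Shimura1973, §7.2–7.3] -/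
def heckeFamily (hHD : exists_isReal_hodgeModel) (hI : hodgePQ_independent_of_hodgeModel) (h₁ : BallQuotientUniformised)
    (h₃ : CMAbelianVarietyRealised) : HeckeFamily (picardCMUniverse hHD hI h₁ h₃) where
  tr {L} {_ι₁} {V} Γ Γ' := {g | ∃ (γ : GL (Fin 3) L) (hγ : γ ∈ unitaryGroup (cmConjRingHom L) V.Hm),
    LiesOver hHD hI h₁ h₃ Γ Γ' g γ hγ}

variable {hHD : exists_isReal_hodgeModel} {hI : hodgePQ_independent_of_hodgeModel} {h₁ : BallQuotientUniformised}
  {h₃ : CMAbelianVarietyRealised}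

/-- Membership in the honest Hecke family, unfolded. [folklore] -/
theorem mem_heckeFamily_tr_iff {L : CMField} {ι₁ : L →+* ℂ} {V : HermSpace3 L ι₁} {Γ Γ' : Level V}
    {g : (picardCMUniverse hHD hI h₁ h₃).Mor ((picardCMUniverse hHD hI h₁ h₃).pms L ι₁ V Γ')
      ((picardCMUniverse hHD hI h₁ h₃).pms L ι₁ V Γ)} :
    g ∈ (heckeFamily hHD hI h₁ h₃).tr Γ Γ' ↔
      ∃ (γ : GL (Fin 3) L) (hγ : γ ∈ unitaryGroup (cmConjRingHom L) V.Hm), LiesOver hHD hI h₁ h₃ Γ Γ' g γ hγ :=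
  Iff.rfl

/-- A morphism lying over a rational isometry is in the family. [folklore] -/
theorem mem_heckeFamily_tr_of_liesOver {L : CMField} {ι₁ : L →+* ℂ} {V : HermSpace3 L ι₁} {Γ Γ' : Level V}
    {g : (picardCMUniverse hHD hI h₁ h₃).Mor ((picardCMUniverse hHD hI h₁ h₃).pms L ι₁ V Γ')
      ((picardCMUniverse hHD hI h₁ h₃).pms L ι₁ V Γ)}
    {γ : GL (Fin 3) L} {hγ : γ ∈ unitaryGroup (cmConjRingHom L) V.Hm} (hg : LiesOver hHD hI h₁ h₃ Γ Γ' g γ hγ) :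
    g ∈ (heckeFamily hHD hI h₁ h₃).tr Γ Γ' :=
  ⟨γ, hγ, hg⟩

namespace LiesOver

variable {L : CMField} {ι₁ : L →+* ℂ} {V : HermSpace3 L ι₁} {Γ Γ' : Level V}
  {g : (picardCMUniverse hHD hI h₁ h₃).Mor ((picardCMUniverse hHD hI h₁ h₃).pms L ι₁ V Γ')
    ((picardCMUniverse hHD hI h₁ h₃).pms L ι₁ V Γ)}
  {γ : GL (Fin 3) L} {hγ : γ ∈ unitaryGroup (cmConjRingHom L) V.Hm}

/-- A morphism over `γ` starts from a level finer than `Γ` (`K`-order). [folklore] -/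
theorem le (hg : LiesOver hHD hI h₁ h₃ Γ Γ' g γ hγ) : Γ' ≤ Γ := hg.1.trans (Γ.heckePair_le hγ)

/-- A morphism over `γ` starts from a level `Γ'` with `γ Γ' γ⁻¹ ≤ Γ` in `GL₃(L)` — the hypothesis of Shimura's
`[v] ↦ [γ v] : X_{Γ'} → X_Γ`. [cite: Shimura1973, §7.2–7.3] -/
theorem map_conj_Γ_le (hg : LiesOver hHD hI h₁ h₃ Γ Γ' g γ hγ) : Γ'.Γ.map (MulAut.conj γ).toMonoidHom ≤ Γ.Γ :=
  (Subgroup.map_mono (Level.Γ_mono hg.1)).trans (Γ.map_conj_heckePair_Γ_le hγ)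

/-- The point action of a morphism over `γ`: `g(ℂ) (unif_{Γ'} v) = unif_Γ (γ^{ι₁} v)` on the negative cone.
[cite: Shimura1973, §7.2–7.3] -/
theorem map_unif (hg : LiesOver hHD hI h₁ h₃ Γ Γ' g γ hγ) (h' : (pmsCode L ι₁ V Γ').IsAnisotropic)
    (h : (pmsCode L ι₁ V Γ).IsAnisotropic)
    {v : Fin 3 → ℂ} (hv : v ∈ (Var.ballDatum (ballQuotientUniformisedDatum_of h₁) h₃ (pmsCode L ι₁ V Γ') h').cone) :
    AlgPoints.map g ((Var.ballDatum (ballQuotientUniformisedDatum_of h₁) h₃ (pmsCode L ι₁ V Γ') h').unif v) =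
      (Var.ballDatum (ballQuotientUniformisedDatum_of h₁) h₃ (pmsCode L ι₁ V Γ) h).unif
        (((γ : Matrix (Fin 3) (Fin 3) L).map ι₁) *ᵥ v) :=
  hg.2 h' h v hv

/-- `γ^{ι₁}` is a real point `∈ U(H^{τ₁})` of the ball datum of the target (for `classLift_pull_mulVec`).
[cite: BergeronMillsonMoeglin2016Balls, Part 2 §1.2] -/
theorem map_ι₁_mem_realPoints (_hg : LiesOver hHD hI h₁ h₃ Γ Γ' g γ hγ) (h : (pmsCode L ι₁ V Γ).IsAnisotropic) :
    Matrix.GeneralLinearGroup.map ι₁ γ ∈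
      (Var.ballDatum (ballQuotientUniformisedDatum_of h₁) h₃ (pmsCode L ι₁ V Γ) h).realPoints :=
  map_ι₁_mem_realPoints_ballDatum (ballQuotientUniformisedDatum_of h₁) h₃ Γ h hγ

end LiesOver

/-- A finer level is finer than the Hecke level of `γ = 1`: `Γ' ≤ Γ ⇒ Γ' ≤ Γ.heckePair 1` (`K' ≤ K = K ∩ 1⁻¹K1`).
[folklore] -/
theorem le_heckePair_one {L : CMField} {ι₁ : L →+* ℂ} {V : HermSpace3 L ι₁} {Γ Γ' : Level V} (hle : Γ' ≤ Γ) :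
    Γ' ≤ Γ.heckePair 1 (Subgroup.one_mem _) := by
  rw [Level.le_def, Level.heckePair_K, UnitaryGroup.conjPair]
  refine le_inf (Level.le_def.1 hle) fun x hx ↦ ⟨x, Level.le_def.1 hle hx, ?_⟩
  have h1 : Level.rationalOf V (1 : GL (Fin 3) L) (Subgroup.one_mem _) = 1 := rfl
  simp [h1]

/-- **The Hecke level of `γ = 1` is coarsest among the Hecke levels at `Γ`**: `Γ.heckePair γ ≤ Γ.heckePair 1`
(`K ∩ γ_f⁻¹Kγ_f ≤ K`). [folklore] -/
theorem heckePair_le_heckePair_one {L : CMField} {ι₁ : L →+* ℂ} {V : HermSpace3 L ι₁} (Γ : Level V)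
    {γ : GL (Fin 3) L} (hγ : γ ∈ unitaryGroup (cmConjRingHom L) V.Hm) :
    Γ.heckePair γ hγ ≤ Γ.heckePair 1 (Subgroup.one_mem _) :=
  le_heckePair_one (Γ.heckePair_le hγ)

/-- **A level covering lies over `γ = 1`**: a morphism `U.pms L ι₁ V Γ' ⟶ U.pms L ι₁ V Γ` over `[v] ↦ [v]` with
`Γ' ≤ Γ` is in the family (e.g. `Model.exists_mor_pms_map_unif` of `CorCM/B01/LevelCovering.lean`). [folklore] -/
theorem mem_heckeFamily_tr_of_cover {L : CMField} {ι₁ : L →+* ℂ} {V : HermSpace3 L ι₁} {Γ Γ' : Level V}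
    (hle : Γ' ≤ Γ)
    {g : (picardCMUniverse hHD hI h₁ h₃).Mor ((picardCMUniverse hHD hI h₁ h₃).pms L ι₁ V Γ')
      ((picardCMUniverse hHD hI h₁ h₃).pms L ι₁ V Γ)}
    (hg : ∀ (h' : (pmsCode L ι₁ V Γ').IsAnisotropic) (h : (pmsCode L ι₁ V Γ).IsAnisotropic),
      ∀ v ∈ (Var.ballDatum (ballQuotientUniformisedDatum_of h₁) h₃ (pmsCode L ι₁ V Γ') h').cone,
        AlgPoints.map g ((Var.ballDatum (ballQuotientUniformisedDatum_of h₁) h₃ (pmsCode L ι₁ V Γ') h').unif v) =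
          (Var.ballDatum (ballQuotientUniformisedDatum_of h₁) h₃ (pmsCode L ι₁ V Γ) h).unif v) :
    g ∈ (heckeFamily hHD hI h₁ h₃).tr Γ Γ' := by
  refine ⟨1, Subgroup.one_mem _, le_heckePair_one hle, fun h' h v hv ↦ ?_⟩
  rw [hg h' h v hv, Units.val_one, Matrix.map_one ι₁ (map_zero ι₁) (map_one ι₁), Matrix.one_mulVec]

/-! ## Off the anisotropic locus -/

/-- Off the anisotropic locus every degree-one class of `U.pms L ι₁ V Γ` is `0` (the surface is the dummy `ℙ²_ℂ`;
`Model.universeOf_cohC_pms_one_eq_zero_of_not_isAnisotropic`). [folklore] -/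
theorem cohC_pms_one_eq_zero_of_not_isAnisotropic {L : CMField} {ι₁ : L →+* ℂ} {V : HermSpace3 L ι₁} (Γ : Level V)
    (hc : ¬ (pmsCode L ι₁ V Γ).IsAnisotropic)
    (a : (picardCMUniverse hHD hI h₁ h₃).CohC ((picardCMUniverse hHD hI h₁ h₃).pms L ι₁ V Γ) 1) : a = 0 :=
  universeOf_cohC_pms_one_eq_zero_of_not_isAnisotropic hHD hI (ballQuotientUniformisedDatum_of h₁) h₃ Γ hc a

/-! ## The body at an anisotropic code, witnesses remembered -/

/-- **B01-H WITHIN the honest Hecke family, at an anisotropic code.**  For `U = picardCMUniverse hHD hI h₁ h₃`, a level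
`Γ` whose Picard code is anisotropic and non-zero `a, a' ∈ H^{1,0}(U.pms L ι₁ V Γ)`: there are a rational isometry
`γ ∈ U(V₃,h)(L)` and, at the Hecke level `Γ' = Γ.heckePair γ` (`= Γ ∩ γ⁻¹Γγ`), the two projections `π_γ` (lying over `γ`)
and `π` (lying over `1`) of the Hecke correspondence, both IN `(heckeFamily …).tr Γ Γ'`, with `π_γ^* a ∪ π^* a' ≠ 0`.
Proof = b06's `Model.heckeWedge10_body_of_isAnisotropic` (dense frame image of the rational isometries,
`BallRational.dense_ratSubgroup`; Hecke wedge of the ball quotient, `exists_mem_forall_cup_pull_ne_zero`; morphisms,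
`Model.exists_mor_pms_heckePair`) keeping the witnesses.
[cite: Venkataramana2001, Thm. 8 and Remark, p. 229] [cite: Clozel1993ProduitsII, Introduction (théorème principal)] -/
theorem heckeWedge10Within_body {L : CMField} {ι₁ : L →+* ℂ} {V : HermSpace3 L ι₁} (Γ : Level V)
    (h : (pmsCode L ι₁ V Γ).IsAnisotropic)
    (a a' : (picardCMUniverse hHD hI h₁ h₃).CohC ((picardCMUniverse hHD hI h₁ h₃).pms L ι₁ V Γ) 1)
    (ha : a ∈ ((picardCMUniverse hHD hI h₁ h₃).hodge ((picardCMUniverse hHD hI h₁ h₃).pms L ι₁ V Γ) 1).piece 1 0)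
    (ha' : a' ∈ ((picardCMUniverse hHD hI h₁ h₃).hodge ((picardCMUniverse hHD hI h₁ h₃).pms L ι₁ V Γ) 1).piece 1 0)
    (h0 : a ≠ 0) (h0' : a' ≠ 0) :
    ∃ (γ : GL (Fin 3) L) (hγ : γ ∈ unitaryGroup (cmConjRingHom L) V.Hm)
      (g π : (picardCMUniverse hHD hI h₁ h₃).Mor ((picardCMUniverse hHD hI h₁ h₃).pms L ι₁ V (Γ.heckePair γ hγ))
        ((picardCMUniverse hHD hI h₁ h₃).pms L ι₁ V Γ)),
      LiesOver hHD hI h₁ h₃ Γ (Γ.heckePair γ hγ) g γ hγ ∧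
      LiesOver hHD hI h₁ h₃ Γ (Γ.heckePair γ hγ) π 1 (Subgroup.one_mem _) ∧
      (picardCMUniverse hHD hI h₁ h₃).cup2C ((picardCMUniverse hHD hI h₁ h₃).pms L ι₁ V (Γ.heckePair γ hγ)) 1
        ((picardCMUniverse hHD hI h₁ h₃).pullC g 1 a) ((picardCMUniverse hHD hI h₁ h₃).pullC π 1 a') ≠ 0 := by
  -- the ball datum of the realising surface and a Sylvester frame
  set hU := ballQuotientUniformisedDatum_of h₁ with hUdef
  obtain ⟨𝔣⟩ := (Var.ballDatum hU h₃ (pmsCode L ι₁ V Γ) h).nonempty_sylvesterFrame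
  have hT : (𝔣.T : Matrix (Fin 3) (Fin 3) ℂ)ᴴ * V.Hm.map ι₁ * (𝔣.T : Matrix (Fin 3) (Fin 3) ℂ) = BallModel.J := by
    rw [← ballDatum_Hℂ hU h₃ Γ h]
    exact 𝔣.conjTranspose_mul_mul
  -- the dense subgroup of rational isometries, read on the ball
  have hΔ : Dense ((BallRational.ratSubgroup L ι₁ V.Hm 𝔣.T hT : Subgroup U21) : Set U21) :=
    BallRational.dense_ratSubgroup L ι₁ V.Hm 𝔣.T hT (hermSpace3_transpose_map_complexConj V)
  -- `H^{1,0} ⊆ F¹`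
  have haF : a ∈ (BettiUniverse.hodge hHD (Var.isSmoothProjective hU h₃ (.pms (pmsCode L ι₁ V Γ))) 1).F 1 :=
    HodgeStructure.piece_le_F _ 1 0 ha
  have haF' : a' ∈ (BettiUniverse.hodge hHD (Var.isSmoothProjective hU h₃ (.pms (pmsCode L ι₁ V Γ))) 1).F 1 :=
    HodgeStructure.piece_le_F _ 1 0 ha'
  -- the Hecke wedge of the ball quotient
  obtain ⟨ĝ, hĝΔ, hmain⟩ := (Var.ballDatum hU h₃ (pmsCode L ι₁ V Γ) h).exists_mem_forall_cup_pull_ne_zero hHD hI 𝔣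
    (BallRational.ratSubgroup L ι₁ V.Hm 𝔣.T hT) hΔ haF haF' h0 h0'
  obtain ⟨γ, hγĝ⟩ := MonoidHom.mem_range.1 hĝΔ
  have hγ : (γ : GL (Fin 3) L) ∈ unitaryGroup (cmConjRingHom L) V.Hm := by
    rw [← coe_complexConj_eq_conjRingHomK']
    exact γ.2
  -- the two projections of the Hecke correspondence from the Hecke level
  obtain ⟨π, T, hπT⟩ := exists_mor_pms_heckePair hHD hI h₁ h₃ Γ hγ h
  refine ⟨γ, hγ, T, π, ⟨le_rfl, fun h' h'' v hv ↦ (hπT v hv).2⟩,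
    ⟨heckePair_le_heckePair_one Γ hγ, fun h' h'' v hv ↦ ?_⟩, ?_⟩
  · rw [(hπT v hv).1, Units.val_one, Matrix.map_one ι₁ (map_zero ι₁) (map_one ι₁), Matrix.one_mulVec]
  -- the ball datum of the Hecke level: same hermitian space, same frame matrix
  have h' : (pmsCode L ι₁ V (Γ.heckePair (γ : GL (Fin 3) L) hγ)).IsAnisotropic :=
    (isAnisotropic_pmsCode_iff_of_level Γ (Γ.heckePair (γ : GL (Fin 3) L) hγ)).2 h
  have hH : (Var.ballDatum hU h₃ (pmsCode L ι₁ V (Γ.heckePair (γ : GL (Fin 3) L) hγ)) h').Hℂ =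
      (Var.ballDatum hU h₃ (pmsCode L ι₁ V Γ) h).Hℂ := by
    rw [ballDatum_Hℂ hU h₃ _ h', ballDatum_Hℂ hU h₃ _ h]
  let 𝔣' : (Var.ballDatum hU h₃ (pmsCode L ι₁ V (Γ.heckePair (γ : GL (Fin 3) L) hγ)) h').SylvesterFrame :=
    ⟨𝔣.T, by rw [hH]; exact 𝔣.conjTranspose_mul_mul⟩
  -- `γ^{ι₁} ∈ U(H^{τ₁})`, and its frame image is the ball element `ĝ`
  have hg : Matrix.GeneralLinearGroup.map ι₁ (γ : GL (Fin 3) L) ∈ (Var.ballDatum hU h₃ (pmsCode L ι₁ V Γ) h).realPoints :=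
    map_ι₁_mem_realPoints_ballDatum hU h₃ Γ h hγ
  have hfr : (Var.ballDatum hU h₃ (pmsCode L ι₁ V Γ) h).frameIso 𝔣 ⟨_, hg⟩ = ĝ := by
    rw [← hγĝ]
    apply Subtype.ext
    apply Units.ext
    change BallModel.mat ((Var.ballDatum hU h₃ (pmsCode L ι₁ V Γ) h).frameIso 𝔣 ⟨_, hg⟩) =
      BallModel.mat (BallRational.toBall L ι₁ V.Hm 𝔣.T hT γ)
    rw [UnitaryBallUniformisationDatum.mat_frameIso, BallRational.mat_toBall]
    rfl
  exact hmain _ 𝔣' rfl hg hfr T π (fun v hv ↦ (hπT v hv).2) (fun v hv ↦ (hπT v hv).1)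

/-! ## B01-H within the honest Hecke family -/

/-- **B01-H WITH REMEMBERED TRANSLATES holds on the universe of record**:
`HeckeWedge10Within (picardCMUniverse hHD hI h₁ h₃) (heckeFamily hHD hI h₁ h₃)` (`Item6SupplyAssembly.lean` :175) — two
non-zero `(1,0)`-classes acquire a non-zero cup product after pull-back along two morphisms OF THE HONEST HECKE FAMILY to
the Hecke level (anisotropic codes: `heckeWedge10Within_body`; other codes: `H¹ = 0`, the hypotheses `a ≠ 0` are
contradictory).  This is the input `hW` of the Hecke route `FaceThetaSupply.wedge_of_translateClosed` (:190) for ANY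
theta sets whose translate-closure is known along morphisms over rational isometries only.
[cite: Venkataramana2001, Thm. 8 and Remark, p. 229] [cite: Clozel1993ProduitsII, Introduction (théorème principal)] -/
theorem heckeWedge10Within_holds (hHD : exists_isReal_hodgeModel) (hI : hodgePQ_independent_of_hodgeModel)
    (h₁ : BallQuotientUniformised) (h₃ : CMAbelianVarietyRealised) :
    HeckeWedge10Within (picardCMUniverse hHD hI h₁ h₃) (heckeFamily hHD hI h₁ h₃) := by
  intro L ι₁ V Γ a a' ha ha' h0 h0'
  by_cases hc : (pmsCode L ι₁ V Γ).IsAnisotropic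
  · obtain ⟨γ, hγ, g, π, hg, hπ, hne⟩ := heckeWedge10Within_body Γ hc a a' ha ha' h0 h0'
    exact ⟨Γ.heckePair γ hγ, g, ⟨γ, hγ, hg⟩, π, ⟨1, Subgroup.one_mem _, hπ⟩, hne⟩
  · exact absurd (cohC_pms_one_eq_zero_of_not_isAnisotropic Γ hc a) h0

/-- Forgetting the family: **the leaf B01-H `U.HeckeWedge10`** (`CorCM/B01/FaceInputsSplit.lean` :177) of the universe of
record, by `heckeWedge10_of_within` — the statement of own-b01's `Model.heckeWedge10_holds` (p260689) reached by a second
kernel road; not a refile of that file. [folklore] -/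
theorem heckeWedge10_of_heckeFamily (hHD : exists_isReal_hodgeModel) (hI : hodgePQ_independent_of_hodgeModel)
    (h₁ : BallQuotientUniformised) (h₃ : CMAbelianVarietyRealised) :
    (picardCMUniverse hHD hI h₁ h₃).HeckeWedge10 :=
  heckeWedge10_of_within (heckeWedge10Within_holds hHD hI h₁ h₃)

/-- **Prop 4.3 by the Hecke route on the universe of record, for ANY supply datum whose theta sets are translate-closed
along the honest Hecke family** (`Fact_pull_hodge` is a tree theorem there, `Model.universeOf_fact_pull_hodge`): the
(vi-3) wedge modulo ONLY `S.TranslateClosed (heckeFamily …)`. [folklore] -/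
theorem wedge_of_translateClosed_heckeFamily {hHD : exists_isReal_hodgeModel} {hI : hodgePQ_independent_of_hodgeModel}
    {h₁ : BallQuotientUniformised} {h₃ : CMAbelianVarietyRealised} {L : CMField} {ι₁ : L →+* ℂ} {V : HermSpace3 L ι₁}
    {K : CMField} {Ψ : Fin 4 → CMType K} {σ : K →+* ℂ}
    (S : FaceThetaSupply (picardCMUniverse hHD hI h₁ h₃) ι₁ V K Ψ σ)
    (hT : S.TranslateClosed (heckeFamily hHD hI h₁ h₃)) : S.Wedge :=
  S.wedge_of_translateClosed (universeOf_fact_pull_hodge hHD hI (ballQuotientUniformisedDatum_of h₁) h₃)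
    (heckeWedge10Within_holds hHD hI h₁ h₃) hT

/-- The same on the universe OF RECORD `U_rec` (the four tree theorems plugged in). [folklore] -/
theorem wedge_rec_of_translateClosed {L : CMField} {ι₁ : L →+* ℂ} {V : HermSpace3 L ι₁}
    {K : CMField} {Ψ : Fin 4 → CMType K} {σ : K →+* ℂ}
    (S : FaceThetaSupply (picardCMUniverse exists_isReal_hodgeModel_holds hodgePQ_independent_of_hodgeModel_holds
      BallQuotient.ballQuotientUniformised_holds cmAbelianVarietyRealised_holds) ι₁ V K Ψ σ)
    (hT : S.TranslateClosed (heckeFamily exists_isReal_hodgeModel_holds hodgePQ_independent_of_hodgeModel_holds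
      BallQuotient.ballQuotientUniformised_holds cmAbelianVarietyRealised_holds)) : S.Wedge :=
  wedge_of_translateClosed_heckeFamily S hT

#print axioms heckeWedge10Within_holds
#print axioms wedge_rec_of_translateClosed

end Summit.HodgeConjecture.CorCM.Transposition.Model

end
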